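import Literature.Analysis.FluidPDE.Tao2016AveragedNS.SplitCascadeAsymPastIntegral
import HarnessLib

/-!
# The split Prop. 6.5: the total `a`-asymmetry integral of the fresh shell (past + present)

T. Tao, *Finite time blowup for an averaged three-dimensional Navier–Stokes equation*,
arXiv:1402.0290v3, §6.6 (6.118)/(6.109).
HONEST FRAMING: statements about the SPLIT cascade model system; nothing here proves the split
Prop. 6.5 and nothing here concerns the true Navier–Stokes equations.

The term kept by (6.118)♯/(6.109)♯ (`SplitCascadeScaleOneClose/Regime.lean`,
`SplitCascadeSmallScaleOneAbsorbed.lean`) is `∫_{τ₀}^t (1+ε₀)^{5/2}ε²e^{-K¹⁰}Z̃²_{a,1}` for a present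
time `t ∈ [0, T]`, `T ≤ 100`. Its past half is bounded by `SplitCascadeAsymPastIntegral.lean`
(`≤ Z₁²C₃G₂₄₅`, `Z₁ ∝ C₁(1+ε₀)^{-n₀/2}`), its present half by the window certificate (`|Z̃_{a,1}| ≤ ζ` on
`[0, T]` gives `≤ 100ζ²`): `asym_integral_total_le`. Both are `n₀`-small, which is what makes the
one-sided bound (6.109)♯ `c̃₁(τ₁) ≥ -(1+ε₀)^{-n₀/4}μ₁` available for `n₀` large (`c_one_floor`).

## References

* T. Tao, arXiv:1402.0290v3, §6.6 (6.118), (6.109). [`Tao2016AveragedNS`]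
-/

noncomputable section

open Set MeasureTheory intervalIntegral

namespace Literature.Analysis.FluidPDE

namespace Tao2016AveragedNS

open TaoCascade

section AsymIntegralTotal

variable {γ ε₀ K ε C₁ C₂ C₃ : ℝ} {n₀ N : ℤ} {ηp : ℤ → ℝ} {βp : ℕ → ℝ} {τ : ℤ → ℝ}
  {Y : Fin 4 → ℤ → ℝ → ℝ} {W : Fin 3 → ℤ → ℝ → ℝ} {F : ℤ → ℝ → ℝ}

/-- **The total `a`-asymmetry integral of the fresh shell** at a present time `t ∈ [0, T]`
(`T ≤ 100`, `|Z̃_{a,1}| ≤ ζ` on `[0, T]`):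
`∫_{τ₀}^t (1+ε₀)^{5/2}ε²e^{-K¹⁰}Z̃²_{a,1} ≤ 6ε²e^{-K¹⁰}(Z₁²C₃G₂₄₅ + 100ζ²)` with `Z₁` the past level of
`SplitCascadeAsymPast.lean`. [cite: Tao2016AveragedNS, §6.6 (6.118)] -/
theorem RescaledSplitHypotheses.asym_integral_total_le
    (h : RescaledSplitHypotheses γ ε₀ K ε C₁ C₂ C₃ n₀ N ηp βp τ Y W F) (hε₀ : 0 < ε₀) (hε₀1 : ε₀ < 1)
    (hK : 1 ≤ K) (hε : 0 < ε) (hC₁ : 0 ≤ C₁) (hC₃ : 0 ≤ C₃) (hN : n₀ ≤ N) {T ζ : ℝ} (hT : T ≤ 100)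
    (hζ : ∀ s ∈ Icc 0 T, |W 0 1 s| ≤ ζ) {t : ℝ} (ht : t ∈ Icc 0 T) :
    ∫ s in (τ (n₀ - N))..t, (1 + ε₀) ^ ((5 : ℝ) / 2) * ε ^ 2 * Real.exp (-K ^ 10) * W 0 1 s ^ 2 ≤
      6 * ε ^ 2 * Real.exp (-K ^ 10) *
        ((Real.exp ((6 * (ε + ε ^ 2 + 2 * (ε ^ 2)⁻¹ + ε⁻¹ * K ^ 10) + 36 * K) * Real.sqrt 2 *
            ((K ^ 15)⁻¹ * C₃ * geomConst ε₀ ((248 : ℝ) / 100))) *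
          ((4 * Real.sqrt 3 * C₁ * (1 + ε₀) ^ (-(n₀ : ℝ) / 2)) *
            ((K ^ 15)⁻¹ * C₃ * geomConst ε₀ ((248 : ℝ) / 100)))) ^ 2 *
          C₃ * geomConst ε₀ ((245 : ℝ) / 100) + 100 * ζ ^ 2) := by
  have h0 : (0 : ℝ) < 1 + ε₀ := by linarith
  have hτ00 : τ (n₀ - N) ≤ 0 := h.tau_init_le hN
  have hq6 : (1 + ε₀) ^ ((5 : ℝ) / 2) ≤ 6 := rpow_five_halves_le_six h0.le (by linarith)
  set L : ℝ := (1 + ε₀) ^ ((5 : ℝ) / 2) * ε ^ 2 * Real.exp (-K ^ 10) with hL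
  have hL0 : 0 ≤ L := by positivity
  have hL6 : L ≤ 6 * ε ^ 2 * Real.exp (-K ^ 10) := by
    rw [hL]
    have : 0 ≤ ε ^ 2 * Real.exp (-K ^ 10) := by positivity
    nlinarith
  set Z2 : ℝ := (Real.exp ((6 * (ε + ε ^ 2 + 2 * (ε ^ 2)⁻¹ + ε⁻¹ * K ^ 10) + 36 * K) * Real.sqrt 2 *
      ((K ^ 15)⁻¹ * C₃ * geomConst ε₀ ((248 : ℝ) / 100))) *
    ((4 * Real.sqrt 3 * C₁ * (1 + ε₀) ^ (-(n₀ : ℝ) / 2)) *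
      ((K ^ 15)⁻¹ * C₃ * geomConst ε₀ ((248 : ℝ) / 100)))) ^ 2 *
    C₃ * geomConst ε₀ ((245 : ℝ) / 100) with hZ2
  have hZ2_0 : 0 ≤ Z2 := by
    have := geomConst_pos hε₀ (s := (245 : ℝ) / 100) (by norm_num); positivity
  -- continuity / integrability
  have hWc : ContinuousOn (fun s => W 0 1 s ^ 2) (Icc (τ (n₀ - N)) T) := (h.continuousOn_W 0 1 le_rfl).pow 2
  have hWi : ∀ {x y : ℝ}, τ (n₀ - N) ≤ x → x ≤ y → y ≤ T →
      IntervalIntegrable (fun s => W 0 1 s ^ 2) volume x y :=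
    fun hx hxy hy => (hWc.mono (Icc_subset_Icc hx hy)).intervalIntegrable_of_Icc hxy
  -- pull out the constant and split at `0`
  rw [intervalIntegral.integral_const_mul]
  have hsplit : ∫ s in (τ (n₀ - N))..t, W 0 1 s ^ 2 =
      (∫ s in (τ (n₀ - N))..(0 : ℝ), W 0 1 s ^ 2) + ∫ s in (0 : ℝ)..t, W 0 1 s ^ 2 :=
    (integral_add_adjacent_intervals (hWi le_rfl hτ00 (ht.1.trans ht.2)) (hWi hτ00 ht.1 ht.2)).symm
  -- the past half
  have hpast : ∫ s in (τ (n₀ - N))..(0 : ℝ), W 0 1 s ^ 2 ≤ Z2 := by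
    rcases eq_or_lt_of_le hN with heq | hlt
    · have hτz : τ (n₀ - N) = 0 := by rw [heq, sub_self, h.tau_zero]
      rw [hτz, intervalIntegral.integral_same]; exact hZ2_0
    · have hmem : (0 : ℝ) ∈ Icc (τ (0 - 1)) (τ 0) := by
        refine ⟨?_, by rw [h.tau_zero]⟩
        have := h.tau_lt 0 (by omega) le_rfl
        rw [h.tau_zero] at this
        exact this.le
      have hp := h.integral_sqW_a_one_past_le hε₀ hε₀1 hK hε hC₁ hC₃ (k := 0) (by omega) le_rfl hmem
      simpa only [Int.cast_zero, mul_zero, Real.rpow_zero, mul_one] using hp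
  -- the present half
  have hpres : ∫ s in (0 : ℝ)..t, W 0 1 s ^ 2 ≤ 100 * ζ ^ 2 := by
    have hm : ∫ s in (0 : ℝ)..t, W 0 1 s ^ 2 ≤ ∫ s in (0 : ℝ)..t, ζ ^ 2 := by
      apply integral_mono_on ht.1 (hWi hτ00 ht.1 ht.2) intervalIntegrable_const
      intro s hs
      have hs' := hζ s ⟨hs.1, hs.2.trans ht.2⟩
      rw [← sq_abs]; exact pow_le_pow_left₀ (abs_nonneg _) hs' 2
    rw [intervalIntegral.integral_const, smul_eq_mul] at hm
    have ht100 : t ≤ 100 := ht.2.trans hT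
    have hz2 : 0 ≤ ζ ^ 2 := sq_nonneg _
    nlinarith [ht.1]
  rw [hsplit]
  have hsum0 : 0 ≤ Z2 + 100 * ζ ^ 2 := by positivity
  calc L * ((∫ s in (τ (n₀ - N))..(0 : ℝ), W 0 1 s ^ 2) + ∫ s in (0 : ℝ)..t, W 0 1 s ^ 2)
      ≤ L * (Z2 + 100 * ζ ^ 2) := mul_le_mul_of_nonneg_left (add_le_add hpast hpres) hL0
    _ ≤ 6 * ε ^ 2 * Real.exp (-K ^ 10) * (Z2 + 100 * ζ ^ 2) := mul_le_mul_of_nonneg_right hL6 hsum0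

end AsymIntegralTotal

end Tao2016AveragedNS

end Literature.Analysis.FluidPDE
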